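import Literature.Computability.Cryptography.LiuPassLemma53Assembly
import Literature.Computability.Cryptography.GoldreichLevinTheorem
import Literature.Computability.Cryptography.GoldreichLevinProgram
import HarnessLib

/-!
# Liu–Pass Lemma 5.3 without saturation: the hiding claim by averaging, and `liuPass_lemma53`

`LiuPassLemma53Assembly.lean` proves Liu–Pass's Lemma 5.3 (FOCS 2020, arXiv:2009.11514, §5.3 and
Appendix) from the Goldreich–Levin theorem for hiding functions (`goldreichLevin_hiding_len`) in
the *saturated* form `liuPass_lemma53_sat` — with the extra hypothesis `IsSaturated f S` (every
`S_n` a union of fibres of `f`), used at exactly one place: the **hiding claim** of the Appendix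
("The function `f̂(·,·)` is `𝒮`-hiding"), whose printed proof regains the factor `2^{r(n)-1}` lost
by guessing the hash bits because "any `y ∈ f(S_n)` has at least `2^{r(n)-1}` pre-images" — in
print `f : S_n → {0,1}^*`, so those preimages lie in `S_n`, whereas the tree's `IsRegularOver`
counts preimages in `{0,1}ⁿ` and the named fact `liuPass_lemma53` (`LiuPassCondFromRegular.lean`)
carries no saturation hypothesis.

This file closes that gap and proves the named fact **as stated**, from `goldreichLevin_hiding_len`:

* `L53Params.sum_fibre_ge_dense` — the regain **by averaging** instead of saturation: with
  `q(x') = #{x ∈ S_n : f x = f x'}`, `Q = 2^{r(n)-1}` and any threshold `τ ≥ 0`,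
  `Σ_{x ∈ S_n} Σ_{x' ∈ f⁻¹(f x) ∩ {0,1}ⁿ} p(x') ≥ τQ · (Σ_{x' ∈ S_n} p(x') − τ n |S_n|)` for
  `0 ≤ p ≤ 1`: the elements of `S_n` whose fibre meets `S_n` in fewer than `τQ` points number at
  most `τQ · #f(S_n) ≤ τ · 2ⁿ ≤ τ n |S_n|` (`card_image_mul_le`: `S_n` meets at most `2ⁿ/Q` fibres,
  as the fibres in `{0,1}ⁿ` through `S_n` have size `≥ Q` and are disjoint; density `2ⁿ ≤ n|S_n|`);
* `L53Params.sInvertProb_ge_dense` — hence the printed inverter `𝒜'` (`hidRed`, unchanged) satisfies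
  `Pr_{x ← S_n}[𝒜' inverts f] ≥ ½ τ (hidingProb(g, 𝒜, n) − τ n)` for every `τ ≥ 0`;
* `L53Params.isHidingOver_g_dense` — the hiding claim with `IsSaturated f S` replaced by the density
  hypothesis of Lemma 5.3/Thm 5.5 (`2ⁿ ≤ n · |S_n|`): at a length where `hidingProb ≥ 1/n^d` take
  `τ = 1/(2n^{d+1})`, so `𝒜'` inverts with probability `≥ 1/(8 n^{2d+1})`, contradicting
  `𝒮`-one-wayness (the advice-carrying coin budget `clH` of `LiuPassLemma53HidingMain.lean`, verbatim);
* `L53Params.eventually_pseudorandom_dense`, `L53Params.lemma53_clauses_dense` — the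
  pseudorandomness clause and the five clauses of Lemma 5.3 for the construction, without saturation
  (the assembly of `LiuPassLemma53Assembly.lean`, verbatim);
* `liuPass_lemma53_of_GL : goldreichLevin_hiding_len → liuPass_lemma53` and
  `liuPass_lemma53_of_goldreichLevin_hiding : goldreichLevin_hiding → liuPass_lemma53`;
* `liuPass_lemma53_holds : liuPass_lemma53` — the discharge, feeding in the tree's proof of the
  Goldreich–Levin fact (`GLInv.goldreichLevin_hiding_len_of_eff`, `GoldreichLevinTheorem.lean`, with
  the efficiency of its inverter `GLInv.glInvRun_polyTime_holds`, `GoldreichLevinProgram.lean`).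

So the tree's rendering of Lemma 5.3 (fibres counted in `{0,1}ⁿ`, inversion = any preimage) is not
weaker than what the printed argument supports: the only change to the printed proof is the Markov
step above inside the Claim.

## References

* Y. Liu, R. Pass, *On one-way functions and Kolmogorov complexity*, FOCS 2020
  (arXiv:2009.11514), §5.3 (Lemma 5.3, Def. of `𝒮`-OWF) and Appendix (proof of Lemma 5.3: the
  Claim "`f̂(·,·)` is `𝒮`-hiding" and the hybrid `REAL ≈_c HYB ≈_s U`).
* O. Goldreich, *Foundations of Cryptography I*, CUP 2001, §3.5 (PRGs from regular OWFs).
* I. Haitner, D. Harnik, O. Reingold, *On the power of the randomized iterate*, CRYPTO 2006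
  (hiding functions and Goldreich–Levin).
-/

namespace Literature.Computability.Cryptography

open Finset Filter Asymptotics _root_.Computability Complexity AffineStr

namespace L53Params

variable {Q : L53Params}

/-! ### The regain by averaging (replacing saturation) -/

section Analysis

variable {A : RandAlg (List Bool) (List Bool)} {qA : Polynomial ℕ} {cl : ℕ → ℕ} {r : ℕ → ℕ} {n κ W : ℕ}

/-- **`S_n` meets few fibres**: if every `x ∈ S_n` has at least `2^{r(n)-1}` length-`n` preimages,
then `#f(S_n) · 2^{r(n)-1} ≤ 2ⁿ` (the fibres in `{0,1}ⁿ` through `S_n` are disjoint and large).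
[Y. Liu, R. Pass, FOCS 2020, Appendix (proof of the Claim: "any `y ∈ f(S_n)` has at least
`2^{r(n)-1}` pre-images")] [folklore] -/
theorem card_image_mul_le {S : ∀ n : ℕ, Finset (List.Vector Bool n)}
    (hreg : ∀ x ∈ S n, 2 ^ (r n - 1) ≤ preimCard Q.f n x.toList) :
    ((S n).image fun x => Q.f x.toList).card * 2 ^ (r n - 1) ≤ 2 ^ n := by
  classical
  set Y := (S n).image fun x => Q.f x.toList with hY
  have hfib : ∀ y ∈ Y, 2 ^ (r n - 1) ≤ (univ.filter fun x' : List.Vector Bool n => Q.f x'.toList = y).card := by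
    intro y hy
    obtain ⟨x, hx, rfl⟩ := Finset.mem_image.1 hy
    refine (hreg x hx).trans ?_
    unfold preimCard
    refine Finset.card_le_card fun x' hx' => ?_
    simp only [Finset.mem_filter, Finset.mem_univ, true_and] at hx' ⊢
    exact hx'
  calc Y.card * 2 ^ (r n - 1) = ∑ _y ∈ Y, 2 ^ (r n - 1) := by rw [Finset.sum_const, smul_eq_mul]
    _ ≤ ∑ y ∈ Y, (univ.filter fun x' : List.Vector Bool n => Q.f x'.toList = y).card := Finset.sum_le_sum hfib
    _ = (univ.filter fun x' : List.Vector Bool n => Q.f x'.toList ∈ Y).card :=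
        Finset.sum_card_fiberwise_eq_card_filter _ _ _
    _ ≤ (univ : Finset (List.Vector Bool n)).card := Finset.card_le_univ _
    _ = 2 ^ n := by rw [Finset.card_univ, card_vector, Fintype.card_bool]

/-- **The fibre sum without saturation (regain by averaging).** For `0 ≤ p ≤ 1`, fibres of size
`≥ 2^{r(n)-1}` in `{0,1}ⁿ` on `S_n`, density `2ⁿ ≤ n·|S_n|` and any threshold `τ ≥ 0`:
`τ · 2^{r(n)-1} · (Σ_{x' ∈ S_n} p x' − τ n |S_n|) ≤ Σ_{x ∈ S_n} Σ_{x' ∈ f⁻¹(f x) ∩ {0,1}ⁿ} p x'`.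
The elements `x' ∈ S_n` whose fibre meets `S_n` in `< τ 2^{r(n)-1}` points are at most
`τ 2^{r(n)-1} · #f(S_n) ≤ τ 2ⁿ ≤ τ n |S_n|` in number; all others are counted `≥ τ 2^{r(n)-1}` times.
(Print regains the full `2^{r(n)-1}` because its fibres live inside `S_n`.) [Y. Liu, R. Pass, FOCS
2020, Appendix (proof of the Claim), Markov refinement] [folklore] -/
theorem sum_fibre_ge_dense {S : ∀ n : ℕ, Finset (List.Vector Bool n)}
    (hreg : ∀ x ∈ S n, 2 ^ (r n - 1) ≤ preimCard Q.f n x.toList) (hdense : 2 ^ n ≤ n * (S n).card)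
    (p : List.Vector Bool n → ℝ) (hp : ∀ x', 0 ≤ p x') (hp1 : ∀ x', p x' ≤ 1) {τ : ℝ} (hτ : 0 ≤ τ) :
    τ * (2 : ℝ) ^ (r n - 1) * (∑ x' ∈ S n, p x' - τ * n * (S n).card) ≤
      ∑ x ∈ S n, ∑ x' ∈ Finset.univ.filter (fun x' : List.Vector Bool n => Q.f x'.toList = Q.f x.toList), p x' := by
  classical
  -- swap the sums: `Σ_x Σ_{x' ∈ fibre x} p x' = Σ_{x'} p x' · #{x ∈ S : f x = f x'}`
  have hswap : (∑ x ∈ S n, ∑ x' ∈ Finset.univ.filter (fun x' : List.Vector Bool n => Q.f x'.toList = Q.f x.toList), p x') =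
      ∑ x' : List.Vector Bool n, p x' * ((S n).filter fun x => Q.f x.toList = Q.f x'.toList).card := by
    simp_rw [Finset.sum_filter]
    rw [Finset.sum_comm]
    refine Finset.sum_congr rfl fun x' _ => ?_
    have hF : ((S n).filter fun x => Q.f x'.toList = Q.f x.toList) = (S n).filter fun x => Q.f x.toList = Q.f x'.toList :=
      Finset.filter_congr fun x _ => eq_comm
    rw [← Finset.sum_filter, Finset.sum_const, nsmul_eq_mul, mul_comm, hF]
  have hYQ0 := card_image_mul_le (Q := Q) (r := r) hreg
  rw [hswap]
  -- notation
  set F : List.Vector Bool n → List Bool := fun x => Q.f x.toList with hF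
  set Qr : ℝ := (2 : ℝ) ^ (r n - 1) with hQr
  set qS : List.Vector Bool n → ℕ := fun x' => ((S n).filter fun x => F x = F x').card with hqS
  set Y : Finset (List Bool) := (S n).image F with hY
  have hYQ : (Y.card : ℝ) * Qr ≤ (2 : ℝ) ^ n := by rw [hQr]; exact_mod_cast hYQ0
  -- the bad elements: fibre population below the threshold
  set B : Finset (List.Vector Bool n) := (S n).filter fun x' => (qS x' : ℝ) < τ * Qr with hB
  have hBfib : ∀ y ∈ Y, (((B.filter fun x' => F x' = y).card : ℕ) : ℝ) ≤ τ * Qr := by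
    intro y _
    rcases (B.filter fun x' => F x' = y).eq_empty_or_nonempty with h0 | ⟨x₀, hx₀⟩
    · rw [h0, Finset.card_empty, Nat.cast_zero]; positivity
    · rw [Finset.mem_filter, hB, Finset.mem_filter] at hx₀
      obtain ⟨⟨_, hx₀q⟩, hx₀y⟩ := hx₀
      have hsub : (B.filter fun x' => F x' = y) ⊆ (S n).filter fun x => F x = F x₀ := by
        intro x hx
        rw [Finset.mem_filter] at hx ⊢
        exact ⟨(Finset.mem_filter.1 hx.1).1, by rw [hx.2, hx₀y]⟩
      calc (((B.filter fun x' => F x' = y).card : ℕ) : ℝ) ≤ qS x₀ := by exact_mod_cast Finset.card_le_card hsub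
        _ ≤ τ * Qr := hx₀q.le
  have hBmaps : (B : Set (List.Vector Bool n)).MapsTo F Y := fun x' hx' =>
    Finset.mem_image_of_mem F (Finset.mem_filter.1 (Finset.mem_coe.1 hx')).1
  have hBcard : (B.card : ℝ) ≤ τ * n * (S n).card := by
    have h1 : B.card = ∑ y ∈ Y, (B.filter fun x' => F x' = y).card := Finset.card_eq_sum_card_fiberwise hBmaps
    calc (B.card : ℝ) = ∑ y ∈ Y, (((B.filter fun x' => F x' = y).card : ℕ) : ℝ) := by rw [h1]; push_cast; rfl
      _ ≤ ∑ _y ∈ Y, τ * Qr := Finset.sum_le_sum hBfib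
      _ = τ * (Y.card * Qr) := by rw [Finset.sum_const, nsmul_eq_mul]; ring
      _ ≤ τ * (2 : ℝ) ^ n := mul_le_mul_of_nonneg_left hYQ hτ
      _ ≤ τ * ((n : ℝ) * (S n).card) := mul_le_mul_of_nonneg_left (by exact_mod_cast hdense) hτ
      _ = τ * n * (S n).card := by ring
  -- the good elements are counted at least `τ Q` times
  have hgood : ∀ x' ∈ S n \ B, τ * Qr ≤ qS x' := by
    intro x' hx'
    rw [Finset.mem_sdiff, hB, Finset.mem_filter, not_and, not_lt] at hx'
    exact hx'.2 hx'.1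
  have hsplit : ∑ x' ∈ S n, p x' = ∑ x' ∈ S n \ B, p x' + ∑ x' ∈ B, p x' :=
    (Finset.sum_sdiff (Finset.filter_subset _ (S n))).symm
  have hBsum : ∑ x' ∈ B, p x' ≤ B.card := by
    calc ∑ x' ∈ B, p x' ≤ ∑ _x' ∈ B, (1 : ℝ) := Finset.sum_le_sum fun x' _ => hp1 x'
      _ = B.card := by rw [Finset.sum_const, nsmul_eq_mul, mul_one]
  have hτQ : 0 ≤ τ * Qr := by positivity
  calc τ * Qr * (∑ x' ∈ S n, p x' - τ * n * (S n).card)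
      ≤ τ * Qr * ∑ x' ∈ S n \ B, p x' := mul_le_mul_of_nonneg_left (by linarith) hτQ
    _ = ∑ x' ∈ S n \ B, τ * Qr * p x' := by rw [Finset.mul_sum]
    _ ≤ ∑ x' ∈ S n \ B, p x' * qS x' := Finset.sum_le_sum fun x' hx' => by
        rw [mul_comm]; exact mul_le_mul_of_nonneg_left (hgood x' hx') (hp x')
    _ ≤ ∑ x' ∈ S n, p x' * qS x' :=
        Finset.sum_le_sum_of_subset_of_nonneg Finset.sdiff_subset fun x' _ _ => mul_nonneg (hp x') (Nat.cast_nonneg _)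
    _ ≤ ∑ x' : List.Vector Bool n, p x' * qS x' :=
        Finset.sum_le_sum_of_subset_of_nonneg (Finset.subset_univ _) fun x' _ _ => mul_nonneg (hp x') (Nat.cast_nonneg _)

/-- **The printed inequality without saturation, counting form**: at a block length `n ≥ γ'` where
the coin budget of `𝒜'` is `r(n)·K_b + κ + Base·W` on all inputs `⟨1ⁿ, f x⟩`, `x ∈ S_n`, fibres have
size `≥ 2^{r(n)-1}` in `{0,1}ⁿ` on `S_n`, `2ⁿ ≤ n·|S_n|` and `r(n) ≤ n + 1`: for every `τ ≥ 0`,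
`Pr_{x ← S_n}[𝒜' inverts f] ≥ ½ τ · (hidingProb(g, 𝒜, n) − τ n)`. [Y. Liu, R. Pass, FOCS 2020,
Appendix (proof of the Claim: "`≥ 2^{-r(n)+1} × Pr[𝒜' = x]`"), with the averaged regain of
`sum_fibre_ge_dense`] [folklore] -/
theorem sInvertProb_ge_dense {S : ∀ n : ℕ, Finset (List.Vector Bool n)} (hn : Q.γ' ≤ n)
    (hregL : ∀ x ∈ S n, 2 ^ (r n - 1) ≤ preimCard Q.f n x.toList) (hdense : 2 ^ n ≤ n * (S n).card)
    (hj : r n ≤ n + 1) (hκ : κ < Q.KbH qA n) (hκA : A.coinLen (Q.ℓA n) = κ)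
    (hcl : ∀ x ∈ S n, cl (boolPair (unaryEncodeNat n) (Q.f x.toList)).length = r n * Q.KbH qA n + κ + Q.BaseH qA n * W)
    (hW : Q.m n + n + κ ≤ r n * Q.KbH qA n + κ + Q.BaseH qA n * W) {τ : ℝ} (hτ : 0 ≤ τ) :
    2⁻¹ * τ * (hidingProb (Q.g r) A S Q.m n - τ * n) ≤ sInvertProb Q.f (Q.hidRed A qA cl) S n := by
  classical
  have hS : (S n).Nonempty := nonempty_of_dense hdense
  have hSc : (0 : ℝ) < (S n).card := by exact_mod_cast hS.card_pos
  -- trivial when the bracket is nonpositive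
  rcases le_or_gt (hidingProb (Q.g r) A S Q.m n - τ * n) 0 with hle | hpos
  · exact le_trans (mul_nonpos_of_nonneg_of_nonpos (by positivity) hle) (sInvertProb_nonneg _ _ _ _)
  set C := r n * Q.KbH qA n + κ + Q.BaseH qA n * W with hC
  obtain ⟨W', hW'⟩ : ∃ W', C = Q.m n + (n + (κ + W')) := ⟨C - (Q.m n + n + κ), by omega⟩
  have ha : Q.aOf (r n) n ≤ n := (min_le_right _ _).trans (Q.L_le n)
  have har : Q.aOf (r n) n ≤ r n := Q.aOf_le _ _
  -- per `x`: `Pr[𝒜' inverts at x] ≥ 2^{-a} Σ_{x' ∈ fibre x} p_{x'}` (as in `sInvertProb_ge`)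
  have hx : ∀ x ∈ S n, ((2 : ℝ) ^ Q.aOf (r n) n)⁻¹ *
      ∑ x' ∈ Finset.univ.filter (fun x' : List.Vector Bool n => Q.f x'.toList = Q.f x.toList), pHit Q A r n x' ≤
      (Q.hidRed A qA cl).pr id (boolPair (unaryEncodeNat n) (Q.f x.toList)) {z | Q.f z = Q.f x.toList} := by
    intro x hxS
    have hlen : (Q.hidRed A qA cl).coinLen (id (boolPair (unaryEncodeNat n) (Q.f x.toList))).length = Q.m n + (n + (κ + W')) :=
      (hcl x hxS).trans hW'
    rw [(Q.hidRed A qA cl).pr_eq_uniformAvg id _ {z | Q.f z = Q.f x.toList} hlen, Finset.mul_sum]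
    calc ∑ x' ∈ Finset.univ.filter (fun x' : List.Vector Bool n => Q.f x'.toList = Q.f x.toList), ((2 : ℝ) ^ Q.aOf (r n) n)⁻¹ * pHit Q A r n x'
        = ∑ x' ∈ Finset.univ.filter (fun x' : List.Vector Bool n => Q.f x'.toList = Q.f x.toList),
            uniformAvg (Q.m n + (n + (κ + W'))) (fun c => if hitEv Q A r n κ x' c then (1 : ℝ) else 0) :=
          Finset.sum_congr rfl fun x' _ => (uniformAvg_event x' hκA ha).symm
      _ = uniformAvg (Q.m n + (n + (κ + W'))) (fun c => ∑ x' ∈ Finset.univ.filter (fun x' : List.Vector Bool n => Q.f x'.toList = Q.f x.toList),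
            if hitEv Q A r n κ x' c then (1 : ℝ) else 0) := (uniformAvg_finset_sum _ _).symm
      _ ≤ _ := uniformAvg_mono fun c hc => sum_indicator_le hκ hj x (hc.trans hW'.symm)
  -- sum over `x ∈ S_n` and regain by averaging
  have hp0 : ∀ x', 0 ≤ pHit Q A r n x' := fun x' => uniformAvg_nonneg fun _ => A.pr_nonneg _ _ _
  have hp1 : ∀ x', pHit Q A r n x' ≤ 1 := fun x' => uniformAvg_le_one fun _ => A.pr_le_one _ _ _
  have hfib := sum_fibre_ge_dense (Q := Q) (r := r) hregL hdense (pHit Q A r n) hp0 hp1 hτ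
  have hsum : ((2 : ℝ) ^ Q.aOf (r n) n)⁻¹ * (τ * (2 : ℝ) ^ (r n - 1) * (∑ x' ∈ S n, pHit Q A r n x' - τ * n * (S n).card)) ≤
      ∑ x ∈ S n, (Q.hidRed A qA cl).pr id (boolPair (unaryEncodeNat n) (Q.f x.toList)) {z | Q.f z = Q.f x.toList} := by
    calc ((2 : ℝ) ^ Q.aOf (r n) n)⁻¹ * (τ * (2 : ℝ) ^ (r n - 1) * (∑ x' ∈ S n, pHit Q A r n x' - τ * n * (S n).card))
        ≤ ((2 : ℝ) ^ Q.aOf (r n) n)⁻¹ * ∑ x ∈ S n, ∑ x' ∈ Finset.univ.filter (fun x' : List.Vector Bool n => Q.f x'.toList = Q.f x.toList),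
            pHit Q A r n x' := mul_le_mul_of_nonneg_left hfib (by positivity)
      _ = ∑ x ∈ S n, ((2 : ℝ) ^ Q.aOf (r n) n)⁻¹ * ∑ x' ∈ Finset.univ.filter (fun x' : List.Vector Bool n => Q.f x'.toList = Q.f x.toList),
            pHit Q A r n x' := by rw [Finset.mul_sum]
      _ ≤ _ := Finset.sum_le_sum hx
  -- `2^{-a} 2^{r-1} ≥ ½`
  have hhalf : (2⁻¹ : ℝ) ≤ ((2 : ℝ) ^ Q.aOf (r n) n)⁻¹ * (2 : ℝ) ^ (r n - 1) := by
    rw [← div_eq_inv_mul, le_div_iff₀ (by positivity)]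
    rcases Nat.eq_zero_or_pos (r n) with h0 | hpos'
    · have : Q.aOf (r n) n = 0 := by have := har; omega
      rw [this, h0]; norm_num
    · calc (2⁻¹ : ℝ) * 2 ^ Q.aOf (r n) n ≤ 2⁻¹ * 2 ^ r n := by gcongr; norm_num
        _ = 2 ^ (r n - 1) := by
          obtain ⟨k, hk⟩ : ∃ k, r n = k + 1 := ⟨r n - 1, by omega⟩
          rw [hk, Nat.add_sub_cancel, pow_succ]; ring
  -- the bracket in terms of the sum of the `pHit`
  have hε : hidingProb (Q.g r) A S Q.m n = (∑ x' ∈ S n, pHit Q A r n x') / (S n).card := hidingProb_eq hn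
  have hbr : (∑ x' ∈ S n, pHit Q A r n x' - τ * n * (S n).card) = (hidingProb (Q.g r) A S Q.m n - τ * n) * (S n).card := by
    rw [hε]; field_simp
  have hbr0 : 0 ≤ τ * (hidingProb (Q.g r) A S Q.m n - τ * n) := mul_nonneg hτ hpos.le
  unfold sInvertProb
  rw [le_div_iff₀ hSc]
  calc 2⁻¹ * τ * (hidingProb (Q.g r) A S Q.m n - τ * n) * (S n).card
      = 2⁻¹ * (τ * (hidingProb (Q.g r) A S Q.m n - τ * n)) * (S n).card := by ring
    _ ≤ ((2 : ℝ) ^ Q.aOf (r n) n)⁻¹ * (2 : ℝ) ^ (r n - 1) * (τ * (hidingProb (Q.g r) A S Q.m n - τ * n)) * (S n).card :=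
        mul_le_mul_of_nonneg_right (mul_le_mul_of_nonneg_right hhalf hbr0) hSc.le
    _ = ((2 : ℝ) ^ Q.aOf (r n) n)⁻¹ * (τ * (2 : ℝ) ^ (r n - 1) * (∑ x' ∈ S n, pHit Q A r n x' - τ * n * (S n).card)) := by
        rw [hbr]; ring
    _ ≤ _ := hsum

end Analysis

/-! ### The hiding claim without saturation -/

/-- **The hashed function `g` is `𝒮`-hiding, for dense `𝒮`** (Liu–Pass 2020, Appendix, Claim in
the proof of Lemma 5.3, in the generality of the tree's `liuPass_lemma53`): if `f` is an `𝒮`-one-way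
function, regular over `S` with regularity `r` (fibres counted in `{0,1}ⁿ`), `2ⁿ ≤ n·|S_n|` for
`n ≥ 1`, `|f x| ≤ P(|x|)`, and the printed inverter is efficient (`hidRun_polyTime`, proved in
`LiuPassLemma53HidingProgram.lean`), then `g r (x ‖ ρ) = ρ ‖ h¹_{R₁}(x) ‖ h²_{R₂}(pad (f x))` hides
`x ← S_n`. Compared with `isHidingOver_g`, saturation is replaced by density via
`sInvertProb_ge_dense` with `τ = 1/(2n^{d+1})` at the lengths where `hidingProb ≥ 1/n^d`.
[Y. Liu, R. Pass, FOCS 2020 (arXiv:2009.11514), Appendix, Claim "`f̂(·,·)` is `𝒮`-hiding"]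
[cite: LiuPassFOCS2020, Lemma 5.3 (proof, Appendix: Claim, f-hat is S-hiding)] -/
theorem isHidingOver_g_dense {S : ∀ n : ℕ, Finset (List.Vector Bool n)} {r : ℕ → ℕ} (hSOWF : IsSOWF Q.f S)
    (hreg : IsRegularOver Q.f S r) (hdense : ∀ n, 1 ≤ n → 2 ^ n ≤ n * (S n).card)
    (hP : ∀ x : List Bool, (Q.f x).length ≤ Q.P.eval x.length) (heff : hidRun_polyTime) :
    IsHidingOver (Q.g r) S Q.m := by
  intro A hA
  by_contra hneg
  obtain ⟨d, hfreq⟩ := exists_frequently_ge_of_not_superpolynomialDecay' (fun n => hidingProb_nonneg _ A S _ n) hneg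
  obtain ⟨qA, hqA⟩ := hA.2
  -- good block lengths
  set Gs : ℕ → Prop := fun n => 1 / (n : ℝ) ^ d ≤ hidingProb (Q.g r) A S Q.m n ∧ Q.γ' ≤ n ∧ 2 ≤ n with hGs
  have hGsf : ∃ᶠ n in atTop, Gs n := hfreq.and_eventually ((eventually_ge_atTop Q.γ').and (eventually_ge_atTop 2))
  have hG' : ∀ a, ∃ b, a ≤ b ∧ Gs b := fun a => by
    obtain ⟨b, hb, hGb⟩ := frequently_atTop.1 hGsf a
    exact ⟨b, hb, hGb⟩
  -- the inverter with the advice-carrying coin budget is PPT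
  set A' := Q.hidRed A qA (Q.clH A qA r Gs) with hA'
  have hPPT : IsPPT A' id := by
    refine ⟨?_, ⟨Q.clPolyH qA, clH_le hqA Gs⟩⟩
    obtain ⟨p, M, hM⟩ := heff Q A qA hA hSOWF.1
    exact ⟨p, M, fun a => hM a⟩
  -- `𝒜'` inverts with negligible probability: eventually `< 1/n^{2d+4}`
  have hdec := hSOWF.2 A' hPPT
  have hev : ∀ᶠ n : ℕ in atTop, sInvertProb Q.f A' S n < 1 / (n : ℝ) ^ (2 * d + 4) :=
    (isNegligible_iff_eventually_lt_of_nonneg (fun n => sInvertProb_nonneg Q.f A' S n)).1 hdec (2 * d + 4)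
  obtain ⟨N₁, hN₁⟩ := eventually_atTop.1 hev
  set n := Yao.seqN Gs Q.spreadH N₁ with hn
  have hNn : N₁ ≤ n := (Yao.seqN_strictMono hG' spreadH_ge).id_le N₁
  obtain ⟨hgood, hγ, hn2⟩ := Yao.seqN_good (w := Q.spreadH) hG' N₁
  have hn1 : 1 ≤ n := by omega
  have hn0 : (0 : ℝ) < n := by exact_mod_cast (show 0 < n by omega)
  have hSn : (S n).Nonempty := nonempty_of_dense (hdense n hn1)
  have hj : r n ≤ n + 1 := r_le_of_regular hreg hSn
  -- the counting inequality at `n`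
  have hκ : Q.κA A n < Q.KbH qA n := κA_lt hqA n
  have hcl : ∀ x ∈ S n, Q.clH A qA r Gs (boolPair (unaryEncodeNat n) (Q.f x.toList)).length =
      r n * Q.KbH qA n + Q.κA A n + Q.BaseH qA n * (1 + Q.m n + n) := by
    intro x _
    rw [← Code_eq hj]
    refine clH_eq hG' N₁ ?_
    have := hP x.toList
    rwa [List.Vector.toList_length] at this
  have hW : Q.m n + n + Q.κA A n ≤ r n * Q.KbH qA n + Q.κA A n + Q.BaseH qA n * (1 + Q.m n + n) := by
    have := room_le (Q := Q) (A := A) (qA := qA) (r := r) n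
    rwa [min_eq_left hj] at this
  set τ : ℝ := 1 / (2 * (n : ℝ) ^ (d + 1)) with hτ
  have hτ0 : 0 ≤ τ := by positivity
  have hmain := sInvertProb_ge_dense (A := A) (qA := qA) (cl := Q.clH A qA r Gs) hγ (fun x hx => (hreg n x hx).1) (hdense n hn1)
    hj hκ rfl hcl hW hτ0
  -- contradiction: `1/(8 n^{2d+1}) ≤ ½ τ (hidingProb − τ n) ≤ sInvertProb < 1/n^{2d+4} ≤ 1/(8 n^{2d+1})`
  have h1 := hN₁ n hNn
  have hn2R : (2 : ℝ) ≤ n := by exact_mod_cast hn2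
  have hτn : τ * n = 1 / (2 * (n : ℝ) ^ d) := by
    rw [hτ, pow_succ]; field_simp
  have hhalf' : 1 / (n : ℝ) ^ d = 2 * (1 / (2 * (n : ℝ) ^ d)) := by field_simp
  have hdiff : 1 / (2 * (n : ℝ) ^ d) ≤ hidingProb (Q.g r) A S Q.m n - τ * n := by
    rw [hτn]; linarith [hgood]
  have hlow : 1 / (8 * (n : ℝ) ^ (2 * d + 1)) ≤ 2⁻¹ * τ * (hidingProb (Q.g r) A S Q.m n - τ * n) :=
    calc 1 / (8 * (n : ℝ) ^ (2 * d + 1)) = 2⁻¹ * τ * (1 / (2 * (n : ℝ) ^ d)) := by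
          rw [hτ, pow_succ, pow_succ, two_mul, pow_add]; field_simp; ring
      _ ≤ _ := mul_le_mul_of_nonneg_left hdiff (by positivity)
  have hup : 1 / (n : ℝ) ^ (2 * d + 4) ≤ 1 / (8 * (n : ℝ) ^ (2 * d + 1)) := by
    refine one_div_le_one_div_of_le (by positivity) ?_
    have h8 : (8 : ℝ) ≤ (n : ℝ) ^ 3 := by
      calc (8 : ℝ) = 2 ^ 3 := by norm_num
        _ ≤ (n : ℝ) ^ 3 := pow_le_pow_left₀ (by norm_num) hn2R 3
    calc 8 * (n : ℝ) ^ (2 * d + 1) ≤ (n : ℝ) ^ 3 * (n : ℝ) ^ (2 * d + 1) :=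
          mul_le_mul_of_nonneg_right h8 (by positivity)
      _ = (n : ℝ) ^ (2 * d + 4) := by rw [← pow_add]; ring_nf
  linarith

/-! ### The pseudorandomness clause and the five clauses, without saturation -/

variable (Q)

/-- **Pseudorandomness (Liu–Pass Lemma 5.3, second clause) for dense `𝒮`, from the Goldreich–Levin
theorem**: `f'_{r(n)}(seed) ‖ GL(seed)` is `4/n^{α'/2}`-indistinguishable from `U_{ℓ'(n)}`, in the
exact form of `liuPass_lemma53` (no saturation hypothesis). The proof of
`L53Params.eventually_pseudorandom` with `isHidingOver_g_dense` in place of `isHidingOver_g`.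
[Y. Liu, R. Pass, FOCS 2020, Lemma 5.3 and Appendix (proof: "`REAL ≈_c HYB₂ ≈_s U`")]
[cite: LiuPassFOCS2020, Lemma 5.3 (proof, Appendix)] -/
theorem eventually_pseudorandom_dense {S : ∀ n : ℕ, Finset (List.Vector Bool n)} {r : ℕ → ℕ}
    (hGL : goldreichLevin_hiding_len) (hSOWF : IsSOWF Q.f S) (hreg : IsRegularOver Q.f S r)
    (hP : ∀ x : List Bool, (Q.f x).length ≤ Q.P.eval x.length) (hdense : ∀ n, 1 ≤ n → 2 ^ n ≤ n * (S n).card)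
    (D : RandAlg (List Bool) Bool) (hD : IsPPT D encodeBool) :
    ∀ᶠ n in atTop, distAdvantage D (fun n => (condUniform (lpSeeds S Q.c n)).map fun w => Q.F (r n) w ++ Q.Hc w)
        (uniformEnsemble fun n => lpLen53 Q.c Q.α' n + Q.γ' * Nat.log 2 n) n ≤ 4 / (n : ℝ) ^ ((Q.α' : ℝ) / 2) := by
  have hne : ∀ᶠ n in atTop, (S n).Nonempty := (eventually_ge_atTop 1).mono fun n hn => nonempty_of_dense (hdense n hn)
  have hhid : IsHidingOver (Q.g r) S Q.m := isHidingOver_g_dense hSOWF hreg hdense hP hidRun_polyTime_holds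
  have hind := hGL S (Q.g r) Q.m Q.γ' _ (fun n x ρ' _ hρ' => Q.hasSeedLength_g r n x ρ' (Finset.mem_univ _) hρ') hne hhid D hD
  have hev1 : ∀ᶠ n : ℕ in atTop, distAdvantage D (glRealEns (Q.g r) S Q.m Q.γ') (glIdealEns (Q.g r) S Q.m Q.γ') n <
      1 / (n : ℝ) ^ Q.α' :=
    (isNegligible_iff_eventually_lt_of_nonneg (fun n => distAdvantage_nonneg _ _ _ n)).1 hind Q.α'
  have hev2 := Q.eventually_density_ideal S r hP (fun n x hx => (hreg n x hx).2) hdense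
  filter_upwards [hev1, hev2, eventually_ge_atTop (max Q.γ' 1)] with n h1 h2 hn
  have hγ : Q.γ' ≤ n := le_trans (le_max_left _ _) hn
  have hn1 : 1 ≤ n := le_trans (le_max_right _ _) hn
  have hSn : (S n).Nonempty := nonempty_of_dense (hdense n hn1)
  rw [distAdvantage_congr_left D (uniformEnsemble fun n => lpLen53 Q.c Q.α' n + Q.γ' * Nat.log 2 n)
    (Q.map_F_append_Hc_eq_glRealEns S r hγ hSn)]
  refine (distAdvantage_triangle D _ (glIdealEns (Q.g r) S Q.m Q.γ') _ n).trans ?_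
  have hA : distAdvantage D (glIdealEns (Q.g r) S Q.m Q.γ') (uniformEnsemble fun n => lpLen53 Q.c Q.α' n + Q.γ' * Nat.log 2 n) n ≤
      3 / (n : ℝ) ^ ((Q.α' : ℝ) / 2) :=
    (distAdvantage_le_tvDist_holds D _ _ n).trans h2
  have hB : distAdvantage D (glRealEns (Q.g r) S Q.m Q.γ') (glIdealEns (Q.g r) S Q.m Q.γ') n ≤ 1 / (n : ℝ) ^ ((Q.α' : ℝ) / 2) :=
    h1.le.trans (one_div_pow_le_one_div_rpow_half hn1)
  calc _ ≤ 1 / (n : ℝ) ^ ((Q.α' : ℝ) / 2) + 3 / (n : ℝ) ^ ((Q.α' : ℝ) / 2) := add_le_add hB hA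
    _ = 4 / (n : ℝ) ^ ((Q.α' : ℝ) / 2) := by ring

/-- **All five clauses of Lemma 5.3 for the construction `Q`, without saturation** (given the
Goldreich–Levin theorem). [Y. Liu, R. Pass, FOCS 2020, Lemma 5.3] [folklore] -/
theorem lemma53_clauses_dense {S : ∀ n : ℕ, Finset (List.Vector Bool n)} {r : ℕ → ℕ}
    (hGL : goldreichLevin_hiding_len) (hSOWF : IsSOWF Q.f S) (hreg : IsRegularOver Q.f S r)
    (hP : ∀ x : List Bool, (Q.f x).length ≤ Q.P.eval x.length) (hdense : ∀ n, 1 ≤ n → 2 ^ n ≤ n * (S n).card) :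
    ∃ (F : ℕ → List Bool → List Bool) (Hc : List Bool → List Bool),
      PolyTimeComputable id id (fun z => F (boolUnpair z).1.length (boolUnpair z).2) ∧
      PolyTimeComputable id id Hc ∧
      (∀ᶠ n in atTop, ∀ w ∈ lpSeeds S Q.c n, (F (r n) w).length = lpLen53 Q.c Q.α' n ∧ (Hc w).length = Q.γ' * Nat.log 2 n) ∧
      (∀ᶠ n in atTop, ((condUniform (lpSeeds S Q.c n)).map (F (r n))).tvDist (uniformBits (lpLen53 Q.c Q.α' n))
          ≤ 3 / (n : ℝ) ^ ((Q.α' : ℝ) / 2)) ∧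
      (∀ D : RandAlg (List Bool) Bool, IsPPT D encodeBool → ∀ᶠ n in atTop,
        distAdvantage D (fun n => (condUniform (lpSeeds S Q.c n)).map fun w => F (r n) w ++ Hc w)
          (uniformEnsemble fun n => lpLen53 Q.c Q.α' n + Q.γ' * Nat.log 2 n) n ≤ 4 / (n : ℝ) ^ ((Q.α' : ℝ) / 2)) :=
  ⟨Q.F, Q.Hc, Q.F_mem_FP hSOWF.1, Q.Hc_mem_FP, Q.eventually_lengths S r,
    Q.eventually_density S r hP (fun n x hx => (hreg n x hx).2) hdense,
    fun D hD => Q.eventually_pseudorandom_dense hGL hSOWF hreg hP hdense D hD⟩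

end L53Params

/-! ### Lemma 5.3 as stated, from the Goldreich–Levin theorem -/

/-- **Liu–Pass 2020, Lemma 5.3 (the named fact `liuPass_lemma53`, no saturation hypothesis) from the
Goldreich–Levin theorem for hiding functions of fixed output length.** The constant is
`c = deg P + 3` for a polynomial bound `P` on `|f x|` (from `f ∈ FP`).
[Y. Liu, R. Pass, FOCS 2020, Lemma 5.3 and Appendix (proof)] [cite: LiuPassFOCS2020, Lemma 5.3] -/
theorem liuPass_lemma53_of_GL (hGL : goldreichLevin_hiding_len) : liuPass_lemma53 := by
  intro f S r hSOWF hreg hdense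
  obtain ⟨P, hP⟩ := exists_poly_length_le_of_mem_FP hSOWF.1
  refine ⟨P.natDegree + 3, by omega, fun α' γ' => ?_⟩
  exact L53Params.lemma53_clauses_dense ⟨f, P, α', γ'⟩ hGL hSOWF hreg hP hdense

/-- **Lemma 5.3 from the general Goldreich–Levin fact `goldreichLevin_hiding`** (which implies its
fixed-output-length form). [Y. Liu, R. Pass, FOCS 2020, Lemma 5.3] [cite: LiuPassFOCS2020, Lemma 5.3] -/
theorem liuPass_lemma53_of_goldreichLevin_hiding (h : goldreichLevin_hiding) : liuPass_lemma53 :=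
  liuPass_lemma53_of_GL (goldreichLevin_hiding_len_of h)

/-- **The saturated form is a special case** (sanity check of the direction of generality).
[Y. Liu, R. Pass, FOCS 2020, Lemma 5.3] [folklore] -/
theorem liuPass_lemma53_sat_of_lemma53 (h : liuPass_lemma53) : liuPass_lemma53_sat :=
  fun f S r hSOWF hreg _ hdense => h f S r hSOWF hreg hdense

/-! ### The discharge -/

/-- **Liu–Pass 2020, Lemma 5.3 holds** (the named fact `liuPass_lemma53` of
`LiuPassCondFromRegular.lean`, discharged): `liuPass_lemma53_of_GL` fed with the tree's proof of the
Goldreich–Levin theorem for hiding functions of fixed output length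
(`GLInv.goldreichLevin_hiding_len_of_eff` with `GLInv.glInvRun_polyTime_holds`). Everything in the
printed proof — Carter–Wegman hashing, the Leftover Hash Lemma (density), the hiding claim (here by
averaging, without saturation) and Goldreich–Levin with `O(log n)` bits (Rackoff's decoder run as a PPT
inverter) — is now proved in the tree. [Y. Liu, R. Pass, FOCS 2020 (arXiv:2009.11514), Lemma 5.3 and
Appendix (proof)] [cite: LiuPassFOCS2020, Lemma 5.3] -/
theorem liuPass_lemma53_holds : liuPass_lemma53 :=
  liuPass_lemma53_of_GL (GLInv.goldreichLevin_hiding_len_of_eff GLInv.glInvRun_polyTime_holds)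

end Literature.Computability.Cryptography
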